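import Mathlib
import Literature.Analysis.OperatorTheory.ContractiveDeterminantalRepresentations
import HarnessLib

/-!
# Stub `stubN_contraction` of line `birth` (crux `ContractivityPrice.PriceOfContractivity`,
item stmt-ValiantsHypothesis-10583) — piece N3 of the weighted model-space colligation

**The contraction.**  Let `Gp` be a positive definite Hermitian `(N+2) × (N+2)` matrix (the Gram
matrix of the weighted model space `W⁺`), `G` its leading `(N+1) × (N+1)` block, and suppose the
Stein identity `v* Gp v = 2 (Ŝv)* G (Ŝv) + |v₀|²` holds, where `(Ŝv)_k = v_{k+1} − v₀ a_{k+1}` is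
the backward shift in coordinates, and `re (φ* Gp φ) ≤ 1/2`.  For `T` with `Tᴴ T = G` (any square
root; `T` is invertible) the colligation
`K' = [[−T S T⁻¹, √2 · T (Ŝφ)], [−(1/√2) e₀ᵀ T⁻¹, φ₀]]` (`S` the companion / backward-shift matrix
of `a`) is a contraction for the Euclidean operator norm.

Proof.  For `x = (v, u)` put `w = T⁻¹ v` and `ĝ = (w, 0) − √2 u φ ∈ ℂ^{N+2}`.  Then
`Ŝĝ = S w − √2 u Ŝφ` (the companion matrix acts as the backward shift on zero-padded vectors),
so `K' x = (−T (Ŝĝ), −ĝ₀/√2)` and `‖K' x‖² = (Ŝĝ)* G (Ŝĝ) + |ĝ₀|²/2 = ½ ĝ* Gp ĝ` by the Stein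
identity.  Writing `Gp = Tpᴴ Tp`, `√(ĝ* Gp ĝ) = ‖Tp ĝ‖ ≤ ‖Tp (w,0)‖ + √2 |u| ‖Tp φ‖ ≤ ‖v‖ + |u|`
(`‖Tp (w,0)‖² = w* G w = ‖T w‖² = ‖v‖²`, `‖Tp φ‖² ≤ 1/2`), whence
`‖K' x‖² ≤ ½ (‖v‖ + |u|)² ≤ ‖v‖² + |u|² = ‖x‖²`.

Pure finite-dimensional linear algebra over Mathlib (square roots of positive matrices through the
continuous functional calculus: `CStarAlgebra.isStrictlyPositive_iff_eq_star_mul_self`); no cited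
facts.  No definitions; pure theorem file serving the lead's skeleton `work/PriceOfContractivity.lean`.
-/

noncomputable section

-- D-0017: a single-problem summit is `Summits/<S>/<S>/…` with namespace `Summit.<S>.<S>.…` by design.
set_option linter.dupNamespace false

namespace Summit.ValiantsHypothesis.ValiantsHypothesis.Theorems.PriceOfContractivity.NormHalvingModelSpace

open Matrix
open scoped ComplexOrder MatrixOrder

/-- `‖B z‖² = re (z* (Bᴴ B) z)` for the Euclidean norm on `ℂ^m`. [folklore] -/
theorem norm_sq_toLp_mulVec {m : Type*} [Fintype m] (B : Matrix m m ℂ) (z : m → ℂ) :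
    ‖(WithLp.toLp 2 (B *ᵥ z) : EuclideanSpace ℂ m)‖ ^ 2 =
      RCLike.re (star z ⬝ᵥ ((Bᴴ * B) *ᵥ z)) := by
  rw [EuclideanSpace.norm_sq_eq, ← Matrix.mulVec_mulVec, Matrix.dotProduct_mulVec,
    ← Matrix.star_mulVec, dotProduct, map_sum]
  refine Finset.sum_congr rfl fun i _ => ?_
  rw [PiLp.toLp_apply, Pi.star_apply, RCLike.star_def, RCLike.conj_mul, ← RCLike.ofReal_pow,
    RCLike.ofReal_re]

/-- The quadratic form of `Gp` on a zero-padded vector `(w, 0)` is the quadratic form of the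
leading block on `w`. [folklore] -/
theorem star_snoc_dotProduct_mulVec_snoc {N : ℕ} (Gp : Matrix (Fin (N + 2)) (Fin (N + 2)) ℂ)
    (w : Fin (N + 1) → ℂ) :
    star (Fin.snoc w 0 : Fin (N + 2) → ℂ) ⬝ᵥ (Gp *ᵥ (Fin.snoc w 0 : Fin (N + 2) → ℂ)) =
      star w ⬝ᵥ (Gp.submatrix Fin.castSucc Fin.castSucc *ᵥ w) := by
  simp [dotProduct, Matrix.mulVec, Fin.sum_univ_castSucc]

/-- The companion (backward-shift) matrix of `a` acts on `w` as the backward shift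
`(Ŝv)_k = v_{k+1} − v₀ a_{k+1}` acts on the zero-padded vector `v = (w, 0)`. [folklore] -/
theorem companion_mulVec_apply {N : ℕ} (a : Polynomial ℂ) (w : Fin (N + 1) → ℂ)
    (k : Fin (N + 1)) :
    (Matrix.of (fun i j : Fin (N + 1) =>
        if (j : ℕ) = 0 then -a.coeff ((i : ℕ) + 1)
        else if (i : ℕ) + 1 = (j : ℕ) then (1 : ℂ) else 0) *ᵥ w) k =
      (Fin.snoc w 0 : Fin (N + 2) → ℂ) k.succ - w 0 * a.coeff ((k : ℕ) + 1) := by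
  simp only [Matrix.mulVec, dotProduct, Matrix.of_apply]
  rw [Fin.sum_univ_succ]
  simp only [Fin.val_zero, ↓reduceIte, Fin.val_succ, Nat.succ_ne_zero, Nat.add_right_cancel_iff,
    ite_mul, one_mul, zero_mul]
  cases k using Fin.lastCases with
  | last =>
    rw [Finset.sum_eq_zero]
    · simp [mul_comm]
    · intro j _
      rw [if_neg]
      simp only [Fin.val_last]
      have := j.is_lt
      omega
  | cast i =>
    rw [Finset.sum_eq_single i, Fin.succ_castSucc, Fin.snoc_castSucc]
    · simp only [Fin.val_castSucc, ↓reduceIte]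
      ring
    · intro j _ hj
      rw [if_neg]
      simp only [Fin.val_castSucc]
      exact fun h => hj (Fin.ext h.symm)
    · simp


/-- **The colligation is a contraction (block form, before reindexing).**  With `G = Tᴴ T` the
leading block of `Gp = Tpᴴ Tp`, the Stein identity and `re (φ* Gp φ) ≤ 1/2`, the block matrix
`[[−T S T⁻¹, √2 · T (Ŝφ)], [−(1/√2) e₀ᵀ T⁻¹, φ₀]]` maps every `x = (v, u) ∈ ℂ^{N+1} ⊕ ℂ` to a vector
of Euclidean norm `≤ ‖x‖`: `‖K' x‖² = ½ ĝ* Gp ĝ ≤ ½ (‖v‖ + |u|)² ≤ ‖x‖²` for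
`ĝ = (T⁻¹ v, 0) − √2 u φ`. [folklore] -/
theorem norm_colligation_apply_le {N : ℕ} (a : Polynomial ℂ)
    (Gp : Matrix (Fin (N + 2)) (Fin (N + 2)) ℂ) (φ : Fin (N + 2) → ℂ)
    (hStein : ∀ v : Fin (N + 2) → ℂ,
        star v ⬝ᵥ (Gp *ᵥ v) =
          2 * (star (fun k : Fin (N + 1) => v k.succ - v 0 * a.coeff ((k : ℕ) + 1)) ⬝ᵥ
            ((Gp.submatrix Fin.castSucc Fin.castSucc) *ᵥ
              (fun k : Fin (N + 1) => v k.succ - v 0 * a.coeff ((k : ℕ) + 1)))) +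
          ((‖v 0‖ ^ 2 : ℝ) : ℂ))
    (hφ : RCLike.re (star φ ⬝ᵥ (Gp *ᵥ φ)) ≤ 1 / 2)
    (T : Matrix (Fin (N + 1)) (Fin (N + 1)) ℂ) (hT : Gp.submatrix Fin.castSucc Fin.castSucc = Tᴴ * T)
    (hTdet : IsUnit T.det) (Tp : Matrix (Fin (N + 2)) (Fin (N + 2)) ℂ) (hTp : Gp = Tpᴴ * Tp)
    (x : EuclideanSpace ℂ (Fin (N + 1) ⊕ Fin 1)) :
    ‖Matrix.toEuclideanCLM (𝕜 := ℂ)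
        (Matrix.fromBlocks
          (-(T * Matrix.of (fun i j : Fin (N + 1) =>
              if (j : ℕ) = 0 then -a.coeff ((i : ℕ) + 1)
              else if (i : ℕ) + 1 = (j : ℕ) then (1 : ℂ) else 0) * T⁻¹))
          (Matrix.replicateCol (Fin 1)
            ((Real.sqrt 2 : ℂ) •
              (T *ᵥ (fun k : Fin (N + 1) => φ k.succ - φ 0 * a.coeff ((k : ℕ) + 1)))))
          (Matrix.replicateRow (Fin 1) (-(((Real.sqrt 2 : ℝ) : ℂ)⁻¹ • (T⁻¹ 0))))
          (φ 0 • (1 : Matrix (Fin 1) (Fin 1) ℂ))) x‖ ≤ ‖x‖ := by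
  -- notation
  set S : Matrix (Fin (N + 1)) (Fin (N + 1)) ℂ := Matrix.of (fun i j : Fin (N + 1) =>
      if (j : ℕ) = 0 then -a.coeff ((i : ℕ) + 1)
      else if (i : ℕ) + 1 = (j : ℕ) then (1 : ℂ) else 0) with hS
  set φ' : Fin (N + 1) → ℂ := fun k : Fin (N + 1) => φ k.succ - φ 0 * a.coeff ((k : ℕ) + 1)
    with hφ'
  set s : ℂ := ((Real.sqrt 2 : ℝ) : ℂ) with hs
  set M : Matrix (Fin (N + 1) ⊕ Fin 1) (Fin (N + 1) ⊕ Fin 1) ℂ :=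
    Matrix.fromBlocks (-(T * S * T⁻¹)) (Matrix.replicateCol (Fin 1) (s • (T *ᵥ φ')))
      (Matrix.replicateRow (Fin 1) (-(s⁻¹ • (T⁻¹ 0)))) (φ 0 • (1 : Matrix (Fin 1) (Fin 1) ℂ))
    with hM
  -- the two components of `x`
  set v : Fin (N + 1) → ℂ := fun i => x (Sum.inl i) with hv
  set u : ℂ := x (Sum.inr 0) with hu
  set w : Fin (N + 1) → ℂ := T⁻¹ *ᵥ v with hw
  -- the test vector `ĝ = (w, 0) − √2 u φ` and its backward shift
  set g : Fin (N + 2) → ℂ := (Fin.snoc w 0 : Fin (N + 2) → ℂ) - (s * u) • φ with hg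
  set g' : Fin (N + 1) → ℂ := S *ᵥ w - (s * u) • φ' with hg'
  have hs0 : s ≠ 0 := by
    rw [hs]
    exact_mod_cast (Real.sqrt_pos.mpr two_pos).ne'
  have hs2 : ‖s‖ ^ 2 = 2 := by
    rw [hs, Complex.norm_real, Real.norm_of_nonneg (Real.sqrt_nonneg _), Real.sq_sqrt zero_le_two]
  have hTw : T *ᵥ w = v := by
    rw [hw, Matrix.mulVec_mulVec, Matrix.mul_nonsing_inv _ hTdet, Matrix.one_mulVec]
  have hg0 : g 0 = w 0 - s * u * φ 0 := by
    simp only [hg, Pi.sub_apply, Pi.smul_apply, smul_eq_mul]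
    rw [show (0 : Fin (N + 2)) = Fin.castSucc (0 : Fin (N + 1)) from rfl, Fin.snoc_castSucc]
  -- `Ŝ ĝ = S w − √2 u Ŝφ`
  have hshift : (fun k : Fin (N + 1) => g k.succ - g 0 * a.coeff ((k : ℕ) + 1)) = g' := by
    ext k
    rw [hg', Pi.sub_apply, Pi.smul_apply, hS, companion_mulVec_apply, hg0]
    simp only [hg, hφ', Pi.sub_apply, Pi.smul_apply, smul_eq_mul]
    ring
  -- the action of the colligation on `x`
  have hx1 : (WithLp.ofLp x ∘ Sum.inl) = v := rfl
  have hx2 : (WithLp.ofLp x ∘ Sum.inr) = fun _ => u := by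
    ext j
    simp [hu, Fin.fin_one_eq_zero j]
  have hcol : ∀ (c : Fin (N + 1) → ℂ) (t : ℂ),
      Matrix.replicateCol (Fin 1) c *ᵥ (fun _ : Fin 1 => t) = t • c := by
    intro c t
    ext i
    simp [Matrix.mulVec, dotProduct, mul_comm]
  have hMx : M *ᵥ WithLp.ofLp x = Sum.elim (-(T *ᵥ g')) (fun _ => -(s⁻¹ * g 0)) := by
    rw [hM, Matrix.fromBlocks_mulVec, hx1, hx2, hcol]
    congr 1
    · rw [Matrix.neg_mulVec, ← Matrix.mulVec_mulVec, ← Matrix.mulVec_mulVec, ← hw, hg',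
        Matrix.mulVec_sub, Matrix.mulVec_smul]
      ext i
      simp only [Pi.add_apply, Pi.neg_apply, Pi.sub_apply, Pi.smul_apply, smul_eq_mul]
      ring
    · ext j
      have hw0 : T⁻¹ 0 ⬝ᵥ v = w 0 := rfl
      simp only [Pi.add_apply, Matrix.replicateRow_mulVec_eq_const, Function.const_apply,
        Matrix.smul_mulVec, Matrix.one_mulVec, Pi.smul_apply, smul_eq_mul, neg_dotProduct,
        smul_dotProduct, hw0, hg0]
      field_simp
      ring
  -- the norms
  have hxn : ‖x‖ ^ 2 = ‖(WithLp.toLp 2 v : EuclideanSpace ℂ (Fin (N + 1)))‖ ^ 2 + ‖u‖ ^ 2 := by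
    simp only [EuclideanSpace.norm_sq_eq, Fintype.sum_sum_type, Finset.univ_unique,
      Finset.sum_singleton, hv, hu]
    rfl
  have hMxn : ‖Matrix.toEuclideanCLM (𝕜 := ℂ) M x‖ ^ 2 =
      ‖(WithLp.toLp 2 (T *ᵥ g') : EuclideanSpace ℂ (Fin (N + 1)))‖ ^ 2 + ‖g 0‖ ^ 2 / 2 := by
    have happ : ∀ i, (Matrix.toEuclideanCLM (𝕜 := ℂ) M x) i = (M *ᵥ WithLp.ofLp x) i :=
      fun i => rfl
    simp only [EuclideanSpace.norm_sq_eq, happ, hMx, Fintype.sum_sum_type, Sum.elim_inl,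
      Sum.elim_inr, Finset.univ_unique, Finset.sum_singleton, Pi.neg_apply, norm_neg,
      norm_mul, norm_inv, mul_pow, inv_pow, hs2]
    ring
  -- quadratic forms as Euclidean norms
  have hQ : ‖(WithLp.toLp 2 (Tp *ᵥ g) : EuclideanSpace ℂ (Fin (N + 2)))‖ ^ 2 =
      RCLike.re (star g ⬝ᵥ (Gp *ᵥ g)) := by
    rw [norm_sq_toLp_mulVec, ← hTp]
  have hA : ‖(WithLp.toLp 2 (T *ᵥ g') : EuclideanSpace ℂ (Fin (N + 1)))‖ ^ 2 =
      RCLike.re (star g' ⬝ᵥ (Gp.submatrix Fin.castSucc Fin.castSucc *ᵥ g')) := by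
    rw [norm_sq_toLp_mulVec, ← hT]
  have hP : ‖(WithLp.toLp 2 (Tp *ᵥ φ) : EuclideanSpace ℂ (Fin (N + 2)))‖ ^ 2 ≤ 1 / 2 := by
    rw [norm_sq_toLp_mulVec, ← hTp]
    exact hφ
  have hR : ‖(WithLp.toLp 2 (Tp *ᵥ (Fin.snoc w 0 : Fin (N + 2) → ℂ)) : EuclideanSpace ℂ (Fin (N + 2)))‖ =
      ‖(WithLp.toLp 2 v : EuclideanSpace ℂ (Fin (N + 1)))‖ := by
    have h1 : ‖(WithLp.toLp 2 (Tp *ᵥ (Fin.snoc w 0 : Fin (N + 2) → ℂ)) :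
        EuclideanSpace ℂ (Fin (N + 2)))‖ ^ 2 =
        ‖(WithLp.toLp 2 v : EuclideanSpace ℂ (Fin (N + 1)))‖ ^ 2 := by
      rw [norm_sq_toLp_mulVec, ← hTp, star_snoc_dotProduct_mulVec_snoc, hT, ← norm_sq_toLp_mulVec,
        hTw]
    exact (pow_left_inj₀ (norm_nonneg _) (norm_nonneg _) two_ne_zero).mp h1
  -- Stein at `ĝ` (real parts)
  have hSg : RCLike.re (star g ⬝ᵥ (Gp *ᵥ g)) =
      2 * RCLike.re (star g' ⬝ᵥ (Gp.submatrix Fin.castSucc Fin.castSucc *ᵥ g')) + ‖g 0‖ ^ 2 := by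
    have h := hStein g
    rw [hshift] at h
    rw [h, show (2 : ℂ) = ((2 : ℝ) : ℂ) by norm_num]
    simp only [RCLike.re_to_complex, Complex.add_re, Complex.re_ofReal_mul, Complex.ofReal_re]
  -- triangle inequality in `ℂ^{N+2}` for `Tp ĝ = Tp (w, 0) − √2 u Tp φ`
  have htri : ‖(WithLp.toLp 2 (Tp *ᵥ g) : EuclideanSpace ℂ (Fin (N + 2)))‖ ≤
      ‖(WithLp.toLp 2 v : EuclideanSpace ℂ (Fin (N + 1)))‖ +
        ‖s * u‖ * ‖(WithLp.toLp 2 (Tp *ᵥ φ) : EuclideanSpace ℂ (Fin (N + 2)))‖ := by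
    have hdec : (WithLp.toLp 2 (Tp *ᵥ g) : EuclideanSpace ℂ (Fin (N + 2))) =
        WithLp.toLp 2 (Tp *ᵥ (Fin.snoc w 0 : Fin (N + 2) → ℂ)) -
          (s * u) • WithLp.toLp 2 (Tp *ᵥ φ) := by
      rw [hg, Matrix.mulVec_sub, Matrix.mulVec_smul, WithLp.toLp_sub, WithLp.toLp_smul]
    rw [hdec, ← hR, ← norm_smul]
    exact norm_sub_le _ _
  -- bookkeeping with real numbers
  have hsP : ‖s * u‖ * ‖(WithLp.toLp 2 (Tp *ᵥ φ) : EuclideanSpace ℂ (Fin (N + 2)))‖ ≤ ‖u‖ := by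
    have h1 : (‖s‖ * ‖(WithLp.toLp 2 (Tp *ᵥ φ) : EuclideanSpace ℂ (Fin (N + 2)))‖) ^ 2 ≤ 1 := by
      rw [mul_pow, hs2]
      linarith
    have h2 : ‖s‖ * ‖(WithLp.toLp 2 (Tp *ᵥ φ) : EuclideanSpace ℂ (Fin (N + 2)))‖ ≤ 1 :=
      (pow_le_one_iff_of_nonneg (mul_nonneg (norm_nonneg _) (norm_nonneg _)) two_ne_zero).mp h1
    rw [norm_mul]
    calc ‖s‖ * ‖u‖ * ‖(WithLp.toLp 2 (Tp *ᵥ φ) : EuclideanSpace ℂ (Fin (N + 2)))‖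
        = ‖u‖ * (‖s‖ * ‖(WithLp.toLp 2 (Tp *ᵥ φ) : EuclideanSpace ℂ (Fin (N + 2)))‖) := by ring
      _ ≤ ‖u‖ * 1 := mul_le_mul_of_nonneg_left h2 (norm_nonneg _)
      _ = ‖u‖ := mul_one _
  have hQle : ‖(WithLp.toLp 2 (Tp *ᵥ g) : EuclideanSpace ℂ (Fin (N + 2)))‖ ≤
      ‖(WithLp.toLp 2 v : EuclideanSpace ℂ (Fin (N + 1)))‖ + ‖u‖ :=
    htri.trans (by linarith)
  have hQsq := pow_le_pow_left₀ (norm_nonneg _) hQle 2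
  have hfin : ‖Matrix.toEuclideanCLM (𝕜 := ℂ) M x‖ ^ 2 ≤ ‖x‖ ^ 2 := by
    rw [hMxn, hxn, hA]
    rw [hQ, hSg] at hQsq
    nlinarith [hQsq, sq_nonneg (‖(WithLp.toLp 2 v : EuclideanSpace ℂ (Fin (N + 1)))‖ - ‖u‖),
      norm_nonneg u, norm_nonneg (WithLp.toLp 2 v : EuclideanSpace ℂ (Fin (N + 1)))]
  exact le_of_pow_le_pow_left₀ two_ne_zero (norm_nonneg _) hfin

/-- **Piece N3 (the contraction).**  If `Gp` is positive definite and satisfies the Stein identity of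
N2, and `φ* Gp φ ≤ 1/2`, then for `T` a square root of the leading block `G` (`Tᴴ T = G`, obtained
from the continuous functional calculus; `T` is invertible) the colligation
`[[−T S T⁻¹, √2 T (Ŝφ)], [−(1/√2) e₀ᵀ T⁻¹, φ₀]]` (`S` the companion / backward-shift matrix of `a`)
has Euclidean operator norm `≤ 1`:
`‖K'(v,u)‖² = ‖T Ŝ ĝ‖² + |ĝ₀|²/2 = ½ ĝ* Gp ĝ` for `ĝ = (T⁻¹v, 0) − √2 u φ`, and
`√(ĝ* Gp ĝ) ≤ ‖v‖ + √2 |u| √(φ* Gp φ) ≤ ‖v‖ + |u|`. [folklore] -/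
theorem stubN_contraction :
    ∀ (N : ℕ) (a : Polynomial ℂ) (Gp : Matrix (Fin (N + 2)) (Fin (N + 2)) ℂ) (φ : Fin (N + 2) → ℂ),
      Gp.IsHermitian → (∀ v : Fin (N + 2) → ℂ, v ≠ 0 → 0 < RCLike.re (star v ⬝ᵥ (Gp *ᵥ v))) →
      (∀ v : Fin (N + 2) → ℂ,
          star v ⬝ᵥ (Gp *ᵥ v) =
            2 * (star (fun k : Fin (N + 1) => v k.succ - v 0 * a.coeff ((k : ℕ) + 1)) ⬝ᵥ
              ((Gp.submatrix Fin.castSucc Fin.castSucc) *ᵥ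
                (fun k : Fin (N + 1) => v k.succ - v 0 * a.coeff ((k : ℕ) + 1)))) +
            ((‖v 0‖ ^ 2 : ℝ) : ℂ)) →
      RCLike.re (star φ ⬝ᵥ (Gp *ᵥ φ)) ≤ 1 / 2 →
      ∃ (T : Matrix (Fin (N + 1)) (Fin (N + 1)) ℂ) (K' : Matrix (Fin (N + 1 + 1)) (Fin (N + 1 + 1)) ℂ),
        IsUnit T.det ∧
        K' = Matrix.reindex finSumFinEquiv finSumFinEquiv
            (Matrix.fromBlocks
              (-(T * Matrix.of (fun i j : Fin (N + 1) =>
                  if (j : ℕ) = 0 then -a.coeff ((i : ℕ) + 1) else if (i : ℕ) + 1 = (j : ℕ) then (1 : ℂ) else 0) * T⁻¹))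
              (Matrix.replicateCol (Fin 1)
                ((Real.sqrt 2 : ℂ) • (T *ᵥ (fun k : Fin (N + 1) => φ k.succ - φ 0 * a.coeff ((k : ℕ) + 1)))))
              (Matrix.replicateRow (Fin 1) (-(((Real.sqrt 2 : ℝ) : ℂ)⁻¹ • (T⁻¹ 0))))
              (φ 0 • (1 : Matrix (Fin 1) (Fin 1) ℂ))) ∧
        ‖Matrix.toEuclideanCLM (𝕜 := ℂ) K'‖ ≤ 1 := by
  intro N a Gp φ hH hpos hStein hφ
  -- `Gp` is positive definite for the `ComplexOrder` (its quadratic form is real by hermiticity)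
  have hGp : Gp.PosDef :=
    Matrix.PosDef.of_dotProduct_mulVec_pos hH fun v hv =>
      RCLike.pos_iff.mpr ⟨hpos v hv, hH.im_star_dotProduct_mulVec_self v⟩
  -- so is its leading block `G`; square roots through the continuous functional calculus
  have hG : (Gp.submatrix Fin.castSucc Fin.castSucc).PosDef :=
    hGp.submatrix (Fin.castSucc_injective _)
  obtain ⟨T, hTu, hT⟩ :=
    CStarAlgebra.isStrictlyPositive_iff_eq_star_mul_self.mp hG.isStrictlyPositive
  obtain ⟨Tp, hTp⟩ := CStarAlgebra.nonneg_iff_eq_star_mul_self.mp hGp.posSemidef.nonneg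
  rw [Matrix.star_eq_conjTranspose] at hT hTp
  have hTdet : IsUnit T.det := (Matrix.isUnit_iff_isUnit_det T).mp hTu
  refine ⟨T, _, hTdet, rfl, ?_⟩
  refine (Literature.Analysis.OperatorTheory.norm_toEuclideanCLM_reindex_le _ _).trans ?_
  refine ContinuousLinearMap.opNorm_le_bound _ zero_le_one fun x => ?_
  rw [one_mul]
  exact norm_colligation_apply_le a Gp φ hStein hφ T hT hTdet Tp hTp x

end Summit.ValiantsHypothesis.ValiantsHypothesis.Theorems.PriceOfContractivity.NormHalvingModelSpace

end
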